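import Summits.HubbardSuperconductivity.HubbardSuperconductivity.Theorems.KLProgrammeSampledPeriodicSymbolKernelL1

/-!
# `ℓ¹` norm and first moment of the lattice position kernel of a sampled smooth periodic symbol — the DERIVATIVE forms

Cell gate-hubbard-kl, seat hubbard-kl-k3c5-p1 (g8).  Sequel of `…SampledPeriodicSymbolKernelL1` (difference forms + mean-value bounds): for a
`(2πℤ)²`-periodic `F : Momentum → ℂ` sampled on the `L`-torus,

* `sum_norm_torusFourierInv_sampled_le_of_fderiv` (`C²`, `‖F‖ ≤ S₀`, `‖DF‖ ≤ S₁`, `‖D²F‖ ≤ S₂`): `Σ_z ‖torusFourierInv (F ∘ P) z‖ ≤ 6(S₀ + πS₁ + π²S₂)`;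
* `sum_abs_valMinAbs_mul_norm_torusFourierInv_sampled_le_of_fderiv` (`C³`, integer scale `R ≥ 1`): `Σ_z |z̃_j|·‖…‖ ≤ 6R(πS₁ + π²S₂/R + π³S₃/R²)`;
* `sum_tnorm_mul_norm_torusFourierInv_sampled_le_of_fderiv`: the torus sup-norm form `Σ_z tnorm(z)·‖…‖ ≤ 12R(…)`,

all uniform in `L`.  Everything is proved; no definitions; nothing about the Hubbard model.
References: S. Friedli, Y. Velenik, *Statistical Mechanics of Lattice Systems*, CUP 2017, §10.4 (`FriedliVelenik2017`).
-/

noncomputable section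

namespace Summit.HubbardSuperconductivity.HubbardSuperconductivity.Theorems.SampledSymbolKernel

set_option linter.dupNamespace false -- summit = problem name (single-conjunct summit), D-0017

open Finset Literature.Probability.LatticeModels Literature.MathematicalPhysics.QuantumLattice
open scoped ComplexConjugate

/-! ### §4 Sampled periodic symbols: the derivative form -/

section Step

variable {L : ℕ} [NeZero L]

/-- The step vector `(2π/L)e_j` has Euclidean length `2π/L`. -/
theorem norm_toLp_step' (j : Fin 2) :
    ‖(WithLp.toLp 2 ((2 * Real.pi / L) • (Pi.single j (1 : ℝ) : Fin 2 → ℝ)) : EuclideanSpace ℝ (Fin 2))‖ = 2 * Real.pi / L := by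
  have hL : (0 : ℝ) < L := Nat.cast_pos.2 (Nat.pos_of_ne_zero (NeZero.ne L))
  rw [WithLp.toLp_smul, norm_smul, Real.norm_eq_abs]
  have : WithLp.toLp 2 (Pi.single j (1 : ℝ) : Fin 2 → ℝ) = PiLp.single 2 j (1 : ℝ) := rfl
  rw [this, PiLp.norm_single, norm_one, mul_one, abs_of_pos (by positivity)]

end Step

section Deriv

variable {L : ℕ} [NeZero L] (F : EuclideanSpace ℝ (Fin 2) → ℂ)
  (hper : ∀ (q : EuclideanSpace ℝ (Fin 2)) (z : Fin 2 → ℤ), F (q + WithLp.toLp 2 (fun i => (z i : ℝ) * (2 * Real.pi))) = F q)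
include hper

/-- **`ℓ¹` bound, derivative form**: a `(2πℤ)²`-periodic `C²` symbol with `‖F‖ ≤ S₀`, `‖DF‖ ≤ S₁`, `‖D²F‖ ≤ S₂` has
`Σ_z ‖torusFourierInv (F ∘ P) z‖ ≤ 6(S₀ + πS₁ + π²S₂)`, uniformly in `L`. -/
theorem sum_norm_torusFourierInv_sampled_le_of_fderiv (hF : ContDiff ℝ 2 F) {S₀ S₁ S₂ : ℝ} (h0 : ∀ q, ‖F q‖ ≤ S₀)
    (h1 : ∀ q, ‖iteratedFDeriv ℝ 1 F q‖ ≤ S₁) (h2 : ∀ q, ‖iteratedFDeriv ℝ 2 F q‖ ≤ S₂) :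
    ∑ z : TorusSite 2 L, ‖torusFourierInv (fun k => F (WithLp.toLp 2 (latticeMomentum L k))) z‖ ≤
      6 * (S₀ + Real.pi * S₁ + Real.pi ^ 2 * S₂) := by
  have hL : (0 : ℝ) < L := Nat.cast_pos.2 (Nat.pos_of_ne_zero (NeZero.ne L))
  have hS00 : 0 ≤ S₀ := (norm_nonneg _).trans (h0 0)
  have hS10 : 0 ≤ S₁ := (norm_nonneg _).trans (h1 0)
  have hS20 : 0 ≤ S₂ := (norm_nonneg _).trans (h2 0)
  set c : ℝ := 2 * Real.pi / L with hc
  have hc0 : 0 < c := by positivity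
  have hD1 : ∀ (q : EuclideanSpace ℝ (Fin 2)) (j : Fin 2),
      ‖F (q + WithLp.toLp 2 ((2 * Real.pi / L) • (Pi.single j (1 : ℝ) : Fin 2 → ℝ))) - F q‖ ≤ S₁ * c := by
    intro q j
    have h := norm_sub_le_of_norm_iteratedFDeriv_one (hF.of_le (by norm_num)) h1
      (q + WithLp.toLp 2 ((2 * Real.pi / L) • (Pi.single j (1 : ℝ) : Fin 2 → ℝ))) q
    rwa [add_sub_cancel_left, norm_toLp_step'] at h
  have hD2 : ∀ q : EuclideanSpace ℝ (Fin 2),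
      ‖F (q + WithLp.toLp 2 ((2 * Real.pi / L) • (Pi.single 0 (1 : ℝ) : Fin 2 → ℝ)) +
          WithLp.toLp 2 ((2 * Real.pi / L) • (Pi.single 1 (1 : ℝ) : Fin 2 → ℝ))) -
        F (q + WithLp.toLp 2 ((2 * Real.pi / L) • (Pi.single 0 (1 : ℝ) : Fin 2 → ℝ))) -
        F (q + WithLp.toLp 2 ((2 * Real.pi / L) • (Pi.single 1 (1 : ℝ) : Fin 2 → ℝ))) + F q‖ ≤ S₂ * c * c := by
    intro q
    have h := norm_second_diff_le_of_norm_iteratedFDeriv_two hF h2 q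
      (WithLp.toLp 2 ((2 * Real.pi / L) • (Pi.single 0 (1 : ℝ) : Fin 2 → ℝ)))
      (WithLp.toLp 2 ((2 * Real.pi / L) • (Pi.single 1 (1 : ℝ) : Fin 2 → ℝ)))
    rwa [norm_toLp_step', norm_toLp_step'] at h
  have hmain := sum_norm_torusFourierInv_sampled_le_of_differences F hper h0 hD1 hD2
  refine hmain.trans ?_
  have hsq : Real.sqrt (S₀ ^ 2 + (L : ℝ) ^ 2 / 8 * (S₁ * c) ^ 2 + (L : ℝ) ^ 4 / 256 * (S₂ * c * c) ^ 2) ≤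
      S₀ + Real.pi * S₁ + Real.pi ^ 2 * S₂ := by
    rw [Real.sqrt_le_left (by positivity)]
    have h8 : (L : ℝ) ^ 2 / 8 * (S₁ * c) ^ 2 = Real.pi ^ 2 * S₁ ^ 2 / 2 := by
      rw [hc]; field_simp; ring
    have h256 : (L : ℝ) ^ 4 / 256 * (S₂ * c * c) ^ 2 = Real.pi ^ 4 * S₂ ^ 2 / 16 := by
      rw [hc]; field_simp; ring
    rw [h8, h256]
    set a := Real.pi * S₁ with ha
    set b := Real.pi ^ 2 * S₂ with hb
    have ha0 : 0 ≤ a := by rw [ha]; positivity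
    have hb0 : 0 ≤ b := by rw [hb]; positivity
    have ea : Real.pi ^ 2 * S₁ ^ 2 / 2 = a ^ 2 / 2 := by rw [ha]; ring
    have eb : Real.pi ^ 4 * S₂ ^ 2 / 16 = b ^ 2 / 16 := by rw [hb]; ring
    rw [ea, eb]
    nlinarith [mul_nonneg hS00 ha0, mul_nonneg hS00 hb0, mul_nonneg ha0 hb0, sq_nonneg a, sq_nonneg b]
  exact mul_le_mul_of_nonneg_left hsq (by norm_num)
set_option maxHeartbeats 400000 in
/-- **First-moment bound, derivative form** (direction `j`, integer scale `R ≥ 1`): a `(2πℤ)²`-periodic `C³` symbol with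
`‖DᵏF‖ ≤ S_k` (`k = 1, 2, 3`) has `Σ_z |z̃_j|·‖torusFourierInv (F ∘ P) z‖ ≤ 6R(πS₁ + π²S₂/R + π³S₃/R²)`, uniformly in `L` — no sup
hypothesis; for a symbol of height `h` varying on the momentum scale `1/R` this is `≍ hR²`. -/
theorem sum_abs_valMinAbs_mul_norm_torusFourierInv_sampled_le_of_fderiv (hF : ContDiff ℝ 3 F) (j : Fin 2) {R : ℕ} (hR : 1 ≤ R)
    {S₁ S₂ S₃ : ℝ} (h1 : ∀ q, ‖iteratedFDeriv ℝ 1 F q‖ ≤ S₁) (h2 : ∀ q, ‖iteratedFDeriv ℝ 2 F q‖ ≤ S₂)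
    (h3 : ∀ q, ‖iteratedFDeriv ℝ 3 F q‖ ≤ S₃) :
    ∑ z : TorusSite 2 L, |((z j).valMinAbs : ℝ)| * ‖torusFourierInv (fun k => F (WithLp.toLp 2 (latticeMomentum L k))) z‖ ≤
      6 * (R : ℝ) * (Real.pi * S₁ + Real.pi ^ 2 * S₂ / R + Real.pi ^ 3 * S₃ / (R : ℝ) ^ 2) := by
  have hL : (0 : ℝ) < L := Nat.cast_pos.2 (Nat.pos_of_ne_zero (NeZero.ne L))
  have hR0 : (0 : ℝ) < R := by exact_mod_cast hR
  have hS10 : 0 ≤ S₁ := (norm_nonneg _).trans (h1 0)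
  have hS20 : 0 ≤ S₂ := (norm_nonneg _).trans (h2 0)
  have hS30 : 0 ≤ S₃ := (norm_nonneg _).trans (h3 0)
  set c : ℝ := 2 * Real.pi / L with hc
  have hc0 : 0 < c := by positivity
  set v : Fin 2 → EuclideanSpace ℝ (Fin 2) := fun i => WithLp.toLp 2 ((2 * Real.pi / L) • (Pi.single i (1 : ℝ) : Fin 2 → ℝ)) with hv
  have hvn : ∀ i, ‖v i‖ = c := fun i => norm_toLp_step' (L := L) i
  have hF2 : ContDiff ℝ 2 F := hF.of_le (by norm_num)
  have hD1 : ∀ q : EuclideanSpace ℝ (Fin 2), ‖F (q + v j) - F q‖ ≤ S₁ * c := by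
    intro q
    have h := norm_sub_le_of_norm_iteratedFDeriv_one (hF.of_le (by norm_num)) h1 (q + v j) q
    rwa [add_sub_cancel_left, hvn] at h
  have hD2 : ∀ (q : EuclideanSpace ℝ (Fin 2)) (i : Fin 2), ‖F (q + v j + v i) - F (q + v j) - F (q + v i) + F q‖ ≤ S₂ * c * c := by
    intro q i
    have h := norm_second_diff_le_of_norm_iteratedFDeriv_two hF2 h2 q (v j) (v i)
    rwa [hvn, hvn] at h
  have hD3 : ∀ q : EuclideanSpace ℝ (Fin 2),
      ‖(F (q + v j + v 0 + v 1) - F (q + v j + v 1) - F (q + v 0 + v 1) + F (q + v 1)) -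
        (F (q + v j + v 0) - F (q + v j) - F (q + v 0) + F q)‖ ≤ S₃ * c * c * c := by
    intro q
    have h := norm_third_diff_le_of_norm_iteratedFDeriv_three hF h3 q (v j) (v 0) (v 1)
    rwa [hvn, hvn, hvn] at h
  have hmain := sum_abs_valMinAbs_mul_norm_torusFourierInv_sampled_le_of_differences F hper j hR hD1 hD2 hD3
  refine hmain.trans ?_
  have hsq : Real.sqrt ((L : ℝ) ^ 2 / 16 * (S₁ * c) ^ 2 + (L : ℝ) ^ 4 / (128 * (R : ℝ) ^ 2) * (S₂ * c * c) ^ 2 +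
      (L : ℝ) ^ 6 / (4096 * (R : ℝ) ^ 4) * (S₃ * c * c * c) ^ 2) ≤
      Real.pi * S₁ + Real.pi ^ 2 * S₂ / R + Real.pi ^ 3 * S₃ / (R : ℝ) ^ 2 := by
    rw [Real.sqrt_le_left (by positivity)]
    have e1 : (L : ℝ) ^ 2 / 16 * (S₁ * c) ^ 2 = Real.pi ^ 2 * S₁ ^ 2 / 4 := by rw [hc]; field_simp; ring
    have e2 : (L : ℝ) ^ 4 / (128 * (R : ℝ) ^ 2) * (S₂ * c * c) ^ 2 = Real.pi ^ 4 * S₂ ^ 2 / (8 * (R : ℝ) ^ 2) := by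
      rw [hc]; field_simp; ring
    have e3 : (L : ℝ) ^ 6 / (4096 * (R : ℝ) ^ 4) * (S₃ * c * c * c) ^ 2 = Real.pi ^ 6 * S₃ ^ 2 / (64 * (R : ℝ) ^ 4) := by
      rw [hc]; field_simp; ring
    rw [e1, e2, e3]
    set a := Real.pi * S₁ with ha
    set b := Real.pi ^ 2 * S₂ / R with hb
    set d := Real.pi ^ 3 * S₃ / (R : ℝ) ^ 2 with hd
    have ha0 : 0 ≤ a := by rw [ha]; positivity
    have hb0 : 0 ≤ b := by rw [hb]; positivity
    have hd0 : 0 ≤ d := by rw [hd]; positivity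
    have f1 : Real.pi ^ 2 * S₁ ^ 2 / 4 ≤ a ^ 2 := by rw [ha]; nlinarith [sq_nonneg (Real.pi * S₁)]
    have f2 : Real.pi ^ 4 * S₂ ^ 2 / (8 * (R : ℝ) ^ 2) ≤ b ^ 2 := by
      rw [hb, div_pow]
      rw [div_le_div_iff₀ (by positivity) (by positivity)]
      nlinarith [sq_nonneg (Real.pi ^ 2 * S₂), sq_nonneg (R : ℝ)]
    have f3 : Real.pi ^ 6 * S₃ ^ 2 / (64 * (R : ℝ) ^ 4) ≤ d ^ 2 := by
      rw [hd, div_pow]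
      rw [div_le_div_iff₀ (by positivity) (by positivity)]
      nlinarith [sq_nonneg (Real.pi ^ 3 * S₃), pow_nonneg hR0.le 4]
    nlinarith [mul_nonneg ha0 hb0, mul_nonneg ha0 hd0, mul_nonneg hb0 hd0]
  exact mul_le_mul_of_nonneg_left hsq (by positivity)

/-- **The torus sup-norm first moment**: `Σ_z tnorm(z)·‖torusFourierInv (F ∘ P) z‖ ≤ 12R(πS₁ + π²S₂/R + π³S₃/R²)`
(`tnorm z ≤ |z̃₀| + |z̃₁|`). -/
theorem sum_tnorm_mul_norm_torusFourierInv_sampled_le_of_fderiv (hF : ContDiff ℝ 3 F) {R : ℕ} (hR : 1 ≤ R)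
    {S₁ S₂ S₃ : ℝ} (h1 : ∀ q, ‖iteratedFDeriv ℝ 1 F q‖ ≤ S₁) (h2 : ∀ q, ‖iteratedFDeriv ℝ 2 F q‖ ≤ S₂)
    (h3 : ∀ q, ‖iteratedFDeriv ℝ 3 F q‖ ≤ S₃) :
    ∑ z : TorusSite 2 L, (Torus.tnorm z : ℝ) * ‖torusFourierInv (fun k => F (WithLp.toLp 2 (latticeMomentum L k))) z‖ ≤
      12 * (R : ℝ) * (Real.pi * S₁ + Real.pi ^ 2 * S₂ / R + Real.pi ^ 3 * S₃ / (R : ℝ) ^ 2) := by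
  have htn : ∀ z : TorusSite 2 L, (Torus.tnorm z : ℝ) ≤ |((z 0).valMinAbs : ℝ)| + |((z 1).valMinAbs : ℝ)| := by
    intro z
    have hle : ∀ i : Fin 2, (Torus.cRep z i).natAbs ≤ (z 0).valMinAbs.natAbs + (z 1).valMinAbs.natAbs := by
      intro i
      have h := Torus.natAbs_cRepZ_le (L := L) (a := z i) (z := (z i).valMinAbs) (ZMod.coe_valMinAbs (z i))
      have h' : (Torus.cRep z i).natAbs ≤ (z i).valMinAbs.natAbs := h
      fin_cases i
      · exact h'.trans (Nat.le_add_right _ _)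
      · exact h'.trans (Nat.le_add_left _ _)
    have h2 : Torus.tnorm z ≤ (z 0).valMinAbs.natAbs + (z 1).valMinAbs.natAbs := Site.supNorm_le_iff.2 hle
    have h3 : (Torus.tnorm z : ℝ) ≤ ((z 0).valMinAbs.natAbs : ℝ) + ((z 1).valMinAbs.natAbs : ℝ) := by exact_mod_cast h2
    rwa [Nat.cast_natAbs, Nat.cast_natAbs, Int.cast_abs, Int.cast_abs] at h3
  have h0 := sum_abs_valMinAbs_mul_norm_torusFourierInv_sampled_le_of_fderiv (L := L) F hper hF (0 : Fin 2) hR h1 h2 h3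
  have h1' := sum_abs_valMinAbs_mul_norm_torusFourierInv_sampled_le_of_fderiv (L := L) F hper hF (1 : Fin 2) hR h1 h2 h3
  calc ∑ z : TorusSite 2 L, (Torus.tnorm z : ℝ) * ‖torusFourierInv (fun k => F (WithLp.toLp 2 (latticeMomentum L k))) z‖
      ≤ ∑ z : TorusSite 2 L, (|((z 0).valMinAbs : ℝ)| + |((z 1).valMinAbs : ℝ)|) *
          ‖torusFourierInv (fun k => F (WithLp.toLp 2 (latticeMomentum L k))) z‖ :=
        sum_le_sum fun z _ => mul_le_mul_of_nonneg_right (htn z) (norm_nonneg _)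
    _ = ∑ z : TorusSite 2 L, |((z 0).valMinAbs : ℝ)| * ‖torusFourierInv (fun k => F (WithLp.toLp 2 (latticeMomentum L k))) z‖ +
          ∑ z : TorusSite 2 L, |((z 1).valMinAbs : ℝ)| * ‖torusFourierInv (fun k => F (WithLp.toLp 2 (latticeMomentum L k))) z‖ := by
        rw [← sum_add_distrib]; exact sum_congr rfl fun z _ => by ring
    _ ≤ _ := by linarith

end Deriv

end Summit.HubbardSuperconductivity.HubbardSuperconductivity.Theorems.SampledSymbolKernel

end
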